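import Summits.BirchSwinnertonDyer.BirchSwinnertonDyer.Theorems.ResidualThetaTransportAtTwoResidualThetaMainConjectureAtTwoLayerReading
import HarnessLib

/-!
# Crux `ResidualThetaMainConjectureAtTwo` (stmt-BirchSwinnertonDyer-20787), line `birth` — by-product:
# the `μ`-READING of Mazur–Tate layers at `2`: `μ_n(θ_n(f)) ≥ μ(L⁻)` at EVERY even layer, with equality
# (and `λ_n = (2ⁿ−1)/3 + λ(L⁻)`) once `n ≥ 2λ(L⁻) + 2`

Cell `bsd-wall`, seat `bsd-wall-rtt-p2` (LEAD PROVER, line mode). THEOREMS ONLY (no `def`, no named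
fact, no `sorry`). Companion of `…MazurTateLayer` / `…LayerReading`: the integral model of a layer element
from a Pollack congruence is refined to carry the EXACT power `p^{μ(L)}` at EVERY layer (the divisibility
`p^{m+μ} ∣ q` needs no largeness of `n`):

* `exists_integralModel_mu_of_isCongrModOmega` — `θ = p^{μ(L)}·P`, `P ∈ ℤ_p[X]`, with
  `P ≡ u X^d L₀ (mod p, X^{pⁿ})` coefficientwise (any `n`, any prime `p`);
* `supNorm_map_le_one` — an integral polynomial has layer sup-norm `≤ 1` under a norm-preserving map;
* **`supNorm_mazurTateElement_two_le`** — for ANY weight-2 cusp form `f` with a Pollack pair at `2` and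
  EVERY even `n`: `max_j |θ_n(f)_j|₂ ≤ 2^{−μ(L⁻)}`, i.e. `μ_n(θ_n) ≥ μ(L⁻)` in Pollack–Weston's layer
  currency; **`mu_eq_zero_of_supNorm_mazurTateElement_two_eq_one`** — so ONE even layer with
  `μ_n(θ_n(f)) = 0` (a unit coefficient) CERTIFIES `μ(L⁻) = 0` (the kernel door from the cell's `μ_n = 0`
  layer tables, KIT-RESULT-TP2-CM-ANCHORS-v1, to the analytic `μ`-clause of `SignedMuAnalyticAtTwoPlus`
  up to the period ratio `ϖ`);
* `supNorm_mazurTateElement_two_eq` — equality `= 2^{−μ(L⁻)}` for even `n ≥ 2λ(L⁻) + 2`.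

References: R. Pollack, Duke Math. J. 118 (2003) Prop. 6.18 [Pollack2003]; R. Pollack, T. Weston, Duke
Math. J. 156 (2011) §3.1, §4 [PollackWeston2011MT]; M. Kurihara, Invent. Math. 149 (2002) [Kurihara2002].
-/

set_option linter.dupNamespace false
set_option autoImplicit false

noncomputable section

open scoped Classical

open Polynomial Literature.NumberTheory.EllipticCurves Literature.NumberTheory.IwasawaTheory
  Summit.BirchSwinnertonDyer.Rank1Residual.X1.MuLambda Summit.BirchSwinnertonDyer.Rank1Residual.Supersingular
  Summit.BirchSwinnertonDyer.Rank1Residual.X2.GreenbergVatsalAnalyticTransferCore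

namespace Summit.BirchSwinnertonDyer.BirchSwinnertonDyer.Theorems.ResidualThetaLayer

section Model

variable {p : ℕ} [hp : Fact p.Prime]

/-- **Integral model with the exact `μ`**: under a Pollack congruence `θ ≡ ω·L (mod ω_n)`
(`IsCongrModOmega p n θ ω L`, `θ_j = 0` for `j ≥ pⁿ`, `ω ≡ u X^d (mod p)`, `L ≠ 0`), `θ = p^{μ(L)} · P`
with `P ∈ ℤ_p[X]` whose reduction below `X^{pⁿ}` is `u·X^d·(L₀ mod p)` (`L = p^{μ(L)} L₀`) — at EVERY layer
`n` (no largeness needed). [cite: Pollack2003, Prop. 6.18] [cite: PollackWeston2011MT, §3.1 and §4] -/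
theorem exists_integralModel_mu_of_isCongrModOmega {n : ℕ} {θ : ℚ[X]} {ω : ℤ[X]}
    {L : IwasawaAlgebra p} {u : ZMod p} {d : ℕ} (hcong : IsCongrModOmega p n θ ω L) (hL : L ≠ 0)
    (hθ : ∀ j, p ^ n ≤ j → θ.coeff j = 0) (hω : ω.map (Int.castRingHom (ZMod p)) = C u * X ^ d) :
    ∃ P : ℤ_[p][X],
      θ.map (algebraMap ℚ ℚ_[p]) = C ((p : ℚ_[p]) ^ mu L) * P.map (algebraMap ℤ_[p] ℚ_[p]) ∧
      ∀ j, j < p ^ n → PadicInt.toZMod (P.coeff j) =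
        u * (if d ≤ j then PowerSeries.coeff (j - d) (PowerSeries.map (PadicInt.toZMod (p := p)) (pfree L))
          else 0) := by
  obtain ⟨m, q, hmq⟩ := hcong
  -- notation: `ι`, `ωΛ`, `ωn`, `θ'`, `bar`
  set ωΛ : IwasawaAlgebra p := ((ω.map (Int.castRingHom ℤ_[p]) : ℤ_[p][X]) : PowerSeries ℤ_[p])
    with hωΛ
  set ωn : IwasawaAlgebra p :=
    (((cyclotomicOmega p n).map (Int.castRingHom ℤ_[p]) : ℤ_[p][X]) : PowerSeries ℤ_[p]) with hωn
  set θ' : PowerSeries ℚ_[p] := ((θ.map (algebraMap ℚ ℚ_[p]) : ℚ_[p][X]) : PowerSeries ℚ_[p])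
    with hθ'
  have hp0 : (p : ℤ_[p]) ≠ 0 := by exact_mod_cast hp.out.ne_zero
  -- `L = p^μ L₀`
  set μ := mu L with hμ
  set L₀ := pfree L with hL₀def
  have hLfac : L = PowerSeries.C ((p : ℤ_[p]) ^ μ) * L₀ := eq_C_pow_mu_mul_pfree L
  have hL₀ : red L₀ ≠ 0 := red_pfree_ne_zero hL
  -- `Θ = p^{m+μ} ω L₀ + ω_n q`, `ι Θ = p^m θ`
  set M := m + μ with hM
  set Θ : IwasawaAlgebra p := PowerSeries.C ((p : ℤ_[p]) ^ M) * (ωΛ * L₀) + ωn * q with hΘ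
  have hkey : PowerSeries.C ((p : ℤ_[p]) ^ M) * (ωΛ * L₀) =
      PowerSeries.C ((p : ℤ_[p]) ^ m) * (ωΛ * L) := by
    rw [hLfac, hM, pow_add, map_mul]; ring
  have hιΘ : iwasawaToPowerSeries p Θ = PowerSeries.C ((p : ℚ_[p]) ^ m) * θ' := by
    have h1 := hmq
    rw [mul_sub, sub_eq_iff_eq_add] at h1
    rw [h1, hΘ, hkey, map_add, map_mul (iwasawaToPowerSeries p) (PowerSeries.C _), iwasawaToPowerSeries,
      PowerSeries.map_C, map_pow, map_natCast, add_comm]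
  have hΘcoeff : ∀ j, p ^ n ≤ j → PowerSeries.coeff j Θ = 0 := by
    intro j hj
    have h1 : PowerSeries.coeff j (iwasawaToPowerSeries p Θ) = 0 := by
      rw [hιΘ, PowerSeries.coeff_C_mul, hθ', Polynomial.coeff_coe, Polynomial.coeff_map, hθ j hj, map_zero,
        mul_zero]
    rw [iwasawaToPowerSeries, PowerSeries.coeff_map] at h1
    exact (IsFractionRing.injective ℤ_[p] ℚ_[p]) (by rw [h1, map_zero])
  -- reductions mod `p`
  have hbarω : PowerSeries.map (PadicInt.toZMod (p := p)) ωΛ = PowerSeries.C u * PowerSeries.X ^ d := by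
    rw [hωΛ, map_coe_polynomial, Polynomial.map_map,
      RingHom.ext_int ((PadicInt.toZMod (p := p)).comp (Int.castRingHom ℤ_[p])) (Int.castRingHom (ZMod p)),
      hω, Polynomial.coe_mul, Polynomial.coe_C, Polynomial.coe_pow, Polynomial.coe_X]
  have hbarωn : PowerSeries.map (PadicInt.toZMod (p := p)) ωn = PowerSeries.X ^ p ^ n :=
    map_toZMod_cyclotomicOmega n
  -- CLAIM A: `p^M ∣ q`
  have hq : ∃ q₁ : IwasawaAlgebra p, q = PowerSeries.C ((p : ℤ_[p]) ^ M) * q₁ := by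
    by_cases hq0 : q = 0
    · exact ⟨0, by rw [hq0, mul_zero]⟩
    set k := mu q with hk
    set q₀ := pfree q with hq₀def
    have hqfac : q = PowerSeries.C ((p : ℤ_[p]) ^ k) * q₀ := eq_C_pow_mu_mul_pfree q
    have hq₀ : red q₀ ≠ 0 := red_pfree_ne_zero hq0
    by_cases hkM : M ≤ k
    · obtain ⟨e, he⟩ := Nat.exists_eq_add_of_le hkM
      exact ⟨PowerSeries.C ((p : ℤ_[p]) ^ e) * q₀, by rw [hqfac, he, pow_add, map_mul, mul_assoc]⟩
    · exfalso
      obtain ⟨e, he⟩ := Nat.exists_eq_add_of_lt (not_le.mp hkM)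
      set Θ' : IwasawaAlgebra p := PowerSeries.C ((p : ℤ_[p]) ^ (e + 1)) * (ωΛ * L₀) + ωn * q₀ with hΘ'
      have hΘfac : Θ = PowerSeries.C ((p : ℤ_[p]) ^ k) * Θ' := by
        rw [hΘ, hqfac, hΘ', he, show k + e + 1 = k + (e + 1) by ring, pow_add, map_mul]; ring
      have hbar : PowerSeries.map (PadicInt.toZMod (p := p)) Θ' =
          PowerSeries.X ^ p ^ n * PowerSeries.map (PadicInt.toZMod (p := p)) q₀ := by
        rw [hΘ']
        simp only [map_add, map_mul]
        rw [map_toZMod_C_p_pow_succ, zero_mul, zero_add, hbarωn]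
      have hq₀bar : PowerSeries.map (PadicInt.toZMod (p := p)) q₀ ≠ 0 := map_toZMod_ne_zero_of_red_ne_zero hq₀
      obtain ⟨i, hi⟩ : ∃ i, PowerSeries.coeff i (PowerSeries.map (PadicInt.toZMod (p := p)) q₀) ≠ 0 := by
        by_contra h
        push Not at h
        exact hq₀bar (PowerSeries.ext fun j ↦ by rw [h j, map_zero])
      have h1 : PowerSeries.coeff (p ^ n + i) (PowerSeries.map (PadicInt.toZMod (p := p)) Θ') ≠ 0 := by
        rw [hbar, PowerSeries.coeff_X_pow_mul', if_pos (Nat.le_add_right _ _), Nat.add_sub_cancel_left]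
        exact hi
      have h2 : PowerSeries.coeff (p ^ n + i) Θ' ≠ 0 := by
        intro h0
        apply h1
        rw [PowerSeries.coeff_map, h0, map_zero]
      have h3 : PowerSeries.coeff (p ^ n + i) Θ = 0 := hΘcoeff _ (Nat.le_add_right _ _)
      rw [hΘfac, PowerSeries.coeff_C_mul, mul_eq_zero] at h3
      rcases h3 with h3 | h3
      · exact pow_ne_zero _ hp0 h3
      · exact h2 h3
  obtain ⟨q₁, hq₁⟩ := hq
  -- `Ψ = ω L₀ + ω_n q₁`, `Θ = p^M Ψ`
  set Ψ : IwasawaAlgebra p := ωΛ * L₀ + ωn * q₁ with hΨ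
  have hΘΨ : Θ = PowerSeries.C ((p : ℤ_[p]) ^ M) * Ψ := by rw [hΘ, hq₁, hΨ]; ring
  have hΨcoeff : ∀ j, p ^ n ≤ j → PowerSeries.coeff j Ψ = 0 := by
    intro j hj
    have h1 := hΘcoeff j hj
    rw [hΘΨ, PowerSeries.coeff_C_mul, mul_eq_zero] at h1
    exact h1.resolve_left (pow_ne_zero _ hp0)
  have hbarΨ : ∀ j, j < p ^ n →
      PowerSeries.coeff j (PowerSeries.map (PadicInt.toZMod (p := p)) Ψ) =
        u * (if d ≤ j then PowerSeries.coeff (j - d) (PowerSeries.map (PadicInt.toZMod (p := p)) L₀) else 0) := by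
    intro j hj
    rw [hΨ, map_add, map_mul, map_mul, hbarω, hbarωn, map_add, mul_assoc, PowerSeries.coeff_C_mul,
      PowerSeries.coeff_X_pow_mul', PowerSeries.coeff_X_pow_mul', if_neg (not_le.mpr hj), add_zero]
  -- the polynomial `P = trunc_{pⁿ} Ψ`
  set P : ℤ_[p][X] := PowerSeries.trunc (p ^ n) Ψ with hP
  have hPΨ : (P : PowerSeries ℤ_[p]) = Ψ := by
    ext j
    rw [Polynomial.coeff_coe, hP, PowerSeries.coeff_trunc]
    split_ifs with h
    · rfl
    · exact (hΨcoeff j (not_lt.mp h)).symm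
  refine ⟨P, ?_, fun j hj ↦ ?_⟩
  · -- `θ = p^μ · P` in `ℚ_p[X]`
    have hθΨ : θ' = PowerSeries.C ((p : ℚ_[p]) ^ μ) * iwasawaToPowerSeries p Ψ := by
      have h1 : PowerSeries.C ((p : ℚ_[p]) ^ m) * θ' =
          PowerSeries.C ((p : ℚ_[p]) ^ m) * (PowerSeries.C ((p : ℚ_[p]) ^ μ) * iwasawaToPowerSeries p Ψ) := by
        rw [← hιΘ, hΘΨ, map_mul, iwasawaToPowerSeries, PowerSeries.map_C, map_pow, map_natCast, hM, pow_add,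
          map_mul, mul_assoc]
      have hC : PowerSeries.C ((p : ℚ_[p]) ^ m) ≠ 0 := by
        rw [Ne, ← map_zero (PowerSeries.C (R := ℚ_[p])), PowerSeries.C_injective.eq_iff]
        exact pow_ne_zero _ (by exact_mod_cast hp.out.ne_zero)
      exact mul_left_cancel₀ hC h1
    apply Polynomial.coe_inj.mp
    rw [Polynomial.coe_mul, Polynomial.coe_C, ← map_coe_polynomial (algebraMap ℤ_[p] ℚ_[p]) P, hPΨ, ← hθ',
      hθΨ]
  · -- the coefficients of `P mod p` below `pⁿ`
    rw [hP, PowerSeries.coeff_trunc, if_pos hj, ← PowerSeries.coeff_map, hbarΨ _ hj]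


/-- An integral polynomial has layer sup-norm `≤ 1` under a norm-preserving ring map. [cite: PollackWeston2011MT, §3.1] -/
theorem supNorm_map_le_one {A : Type*} [NormedRing A] (φ : ℤ_[p] →+* A) (hφ : ∀ x, ‖φ x‖ = ‖x‖)
    (P : ℤ_[p][X]) : (P.map φ).supNorm ≤ 1 := by
  obtain ⟨i, hi⟩ := (P.map φ).exists_eq_supNorm
  rw [hi, coeff_map, hφ]
  exact PadicInt.norm_le_one _

end Model

/-! ## The `μ`-reading at `p = 2` -/

section Two

open scoped MatrixGroups ModularForm

variable {N : ℕ} (f : CuspForm (CongruenceSubgroup.Gamma0 N) 2) {Lplus Lminus : IwasawaAlgebra 2}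

/-- `‖2‖ = 1/2` in `ℚ̄₂`. [folklore] -/
theorem norm_two_padicAlgCl : ‖(2 : PadicAlgCl 2)‖ = (2 : ℝ)⁻¹ := by
  have h := PadicAlgCl.norm_extends 2 ((2 : ℕ) : ℚ_[2])
  rw [map_natCast, Padic.norm_p] at h
  exact_mod_cast h

/-- The integral model of `θ_n(f)` at `p = 2`, even `n`, read in `ℚ̄₂[X]`: `θ_n(f) = 2^{μ(L⁻)} · P^φ` with
`P ∈ ℤ₂[X]` and the coefficient law mod `2`. [cite: Pollack2003, Prop. 6.18] -/
theorem exists_integralModel_mazurTateElement_two (hPP : IsPollackPair f 2 Lplus Lminus) {n : ℕ}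
    (heven : Even n) :
    ∃ P : ℤ_[2][X],
      (mazurTateElement f 2 n).map (algebraMap ℚ (PadicAlgCl 2)) =
        C ((2 : PadicAlgCl 2) ^ mu Lminus) *
          P.map ((algebraMap ℚ_[2] (PadicAlgCl 2)).comp (algebraMap ℤ_[2] ℚ_[2])) ∧
      ∀ j, j < 2 ^ n → PadicInt.toZMod (P.coeff j) =
        (-1 : ZMod 2) ^ (n / 2 + 1) * (if (2 ^ n - 1) / 3 ≤ j then
          PowerSeries.coeff (j - (2 ^ n - 1) / 3) (PowerSeries.map (PadicInt.toZMod (p := 2)) (pfree Lminus))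
          else 0) := by
  have hLm : Lminus ≠ 0 := hPP.2.1
  obtain ⟨j, hj⟩ := heven
  have hj2 : (n + 1) / 2 = j := by omega
  have hω : ((-1) ^ (n / 2 + 1) * cyclotomicOmegaMinus 2 n).map (Int.castRingHom (ZMod 2)) =
      C ((-1 : ZMod 2) ^ (n / 2 + 1)) * X ^ ((2 ^ n - 1) / 3) := by
    rw [Polynomial.map_mul, Polynomial.map_pow, Polynomial.map_neg, Polynomial.map_one,
      map_cyclotomicOmegaMinus_zmod, hj2, sum_two_pow_layer, show 2 * j = n by omega, map_pow, map_neg, C_1]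
  have hθcoeff : ∀ i, 2 ^ n ≤ i → (mazurTateElement f 2 n).coeff i = 0 := fun i hi ↦
    coeff_eq_zero_of_natDegree_lt (lt_of_lt_of_le (natDegree_mazurTateElement_lt f 2 n) hi)
  obtain ⟨P, hθP, hcoeff⟩ := exists_integralModel_mu_of_isCongrModOmega (hPP.2.2.2 n ⟨j, hj⟩) hLm hθcoeff hω
  have hφrat : (algebraMap ℚ_[2] (PadicAlgCl 2)).comp (algebraMap ℚ ℚ_[2]) = algebraMap ℚ (PadicAlgCl 2) :=
    RingHom.ext_rat _ _
  refine ⟨P, ?_, hcoeff⟩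
  rw [← hφrat, ← Polynomial.map_map, hθP, Polynomial.map_mul, Polynomial.map_C, map_pow, map_natCast,
    Nat.cast_ofNat, Polynomial.map_map]

/-- **`μ_n(θ_n(f)) ≥ μ(L⁻)` at EVERY even layer**: `max_j |θ_n(f)_j|₂ ≤ 2^{−μ(L⁻)}` for any weight-2
cusp form `f` with a Pollack pair `(L⁺, L⁻)` at `2`. [cite: Pollack2003, Prop. 6.18] [cite: PollackWeston2011MT, §3.1] -/
theorem supNorm_mazurTateElement_two_le (hPP : IsPollackPair f 2 Lplus Lminus) {n : ℕ} (heven : Even n) :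
    ((mazurTateElement f 2 n).map (algebraMap ℚ (PadicAlgCl 2))).supNorm ≤ (2 : ℝ)⁻¹ ^ mu Lminus := by
  obtain ⟨P, hθP, -⟩ := exists_integralModel_mazurTateElement_two f hPP heven
  rw [hθP, supNorm_C_mul, norm_pow, norm_two_padicAlgCl]
  exact mul_le_of_le_one_right (pow_nonneg (by norm_num) _)
    (supNorm_map_le_one _ norm_algebraMap_padicInt_padicAlgCl P)

/-- **One even layer with a `2`-adic UNIT coefficient certifies `μ(L⁻) = 0`**: if
`max_j |θ_n(f)_j|₂ = 1` (`μ_n(θ_n(f)) = 0`) for some even `n`, then `μ(L⁻) = 0`.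
[cite: Pollack2003, Prop. 6.18] [cite: PollackWeston2011MT, §3.1] -/
theorem mu_eq_zero_of_supNorm_mazurTateElement_two_eq_one (hPP : IsPollackPair f 2 Lplus Lminus) {n : ℕ}
    (heven : Even n) (h1 : ((mazurTateElement f 2 n).map (algebraMap ℚ (PadicAlgCl 2))).supNorm = 1) :
    mu Lminus = 0 := by
  have h := supNorm_mazurTateElement_two_le f hPP heven
  rw [h1] at h
  by_contra hne
  have hlt : ((2 : ℝ)⁻¹) ^ mu Lminus < 1 := pow_lt_one₀ (by norm_num) (by norm_num) hne
  exact absurd h (not_le.mpr hlt)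

/-- **Exact `μ`-reading for large even layers**: `max_j |θ_n(f)_j|₂ = 2^{−μ(L⁻)}` (`μ_n(θ_n) = μ(L⁻)`)
for even `n ≥ 2λ(L⁻) + 2`. [cite: Pollack2003, Prop. 6.18] [cite: PollackWeston2011MT, §3.1 and §4] -/
theorem supNorm_mazurTateElement_two_eq (hPP : IsPollackPair f 2 Lplus Lminus) {n : ℕ}
    (hn : 2 * lam Lminus + 2 ≤ n) (heven : Even n) :
    ((mazurTateElement f 2 n).map (algebraMap ℚ (PadicAlgCl 2))).supNorm = (2 : ℝ)⁻¹ ^ mu Lminus := by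
  have hLm : Lminus ≠ 0 := hPP.2.1
  obtain ⟨P, hθP, hcoeff⟩ := exists_integralModel_mazurTateElement_two f hPP heven
  set d : ℕ := (2 ^ n - 1) / 3 with hd
  have hd' : d + lam Lminus < 2 ^ n := layer_room hn
  -- `ord_X(P mod 2) = d + lam L⁻`: coefficients below vanish, the one at `d + lam L⁻` is a unit
  have hlam := order_map_toZMod_pfree_eq_lam hLm
  rw [PowerSeries.order_eq_nat] at hlam
  obtain ⟨hlamne, hlamlt⟩ := hlam
  have hu : ((-1 : ZMod 2) ^ (n / 2 + 1)) ≠ 0 := pow_ne_zero _ (neg_ne_zero.mpr one_ne_zero)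
  have hk : PadicInt.toZMod (P.coeff (d + lam Lminus)) ≠ 0 := by
    rw [hcoeff _ hd', if_pos (Nat.le_add_right d _), Nat.add_sub_cancel_left]
    exact mul_ne_zero hu hlamne
  have hlt : ∀ i < d + lam Lminus, PadicInt.toZMod (P.coeff i) = 0 := fun i hi ↦ by
    rw [hcoeff _ (hi.trans hd')]
    split_ifs with hdi
    · rw [hlamlt (i - d) (by omega), mul_zero]
    · rw [mul_zero]
  have hsup := (layerLambda_map_eq_of_coeff _ norm_algebraMap_padicInt_padicAlgCl hlt hk).2
  rw [hθP, supNorm_C_mul, norm_pow, norm_two_padicAlgCl, hsup, mul_one]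

end Two

end Summit.BirchSwinnertonDyer.BirchSwinnertonDyer.Theorems.ResidualThetaLayer

end
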